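import Summits.FinalStateConjecture.FinalStateConjecture.Theorems.SwallowTheDatumKerrShieldedDataExistCapMap
import Summits.FinalStateConjecture.FinalStateConjecture.Theorems.SwallowTheDatumKerrShieldedDataExistCapConormal
import HarnessLib

/-!
# `KerrShieldedDataExist`, line `plug-the-second-sheet` (skeleton v4 "KerrCap") — stub `stub_capImmersion`:
# the cap map is a smooth spacelike immersion of `{‖u‖ > σ}` into the ingoing Kerr chart, with a `C^∞`
# future unit normal

Support file (`--supports stmt-FinalStateConjecture-10055`; everything proved, no definitions, no named facts):
the registered stub `stub_capImmersion` of `Cruxes/KerrShieldedDataExist/Lines/plug_the_second_sheet.lean`,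
proved verbatim, for ARBITRARY profiles `(τ, ϱ, α)` with `τ′, ϱ′ ≥ 0` never both `0`, `r₀ ≤ ϱ`,
`ϱ ≤ r_b < r₊` up to `σ₄`, and `τ = T_{M,a} ∘ ϱ + c`, `ϱ′ > 0` from `σ₄` on. With `s = ‖u‖`,
`Φ(u) = (τ(s), X u)`, `X u = L_{ϱ(s)} Rot_z(α(s)) (u/s)` (`…CapMap`: `r(X u) = ϱ(s)`,
`DΦ(u)v = (τ′⟪u,v⟫/s, DX(u)v)`, `dr(DX(u)v) = ϱ′⟪u,v⟫/s`):

* `KerrCap.capNum_neg`: the numerator `−Σϱ′² + τ′²(r² + a²) − 2Mr(ϱ′ + τ′)²` of the `g⁻¹`-square of the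
  conormal `n = ϱ′dt* − τ′dr` is `< 0` at every parameter: on `s ≤ σ₄` because `r₋ < r₀ ≤ ϱ ≤ r_b < r₊`
  gives `Δ(ϱ) < 0` (`…CapConormal.capConormalNum_neg_of_delta_neg`); on `s > σ₄` because there
  `τ′ = T′(ϱ)ϱ′` and the landed certificate `Negative.conormalForm_bentSlope_neg` applies
  (`capConormalNum_neg_of_slope`);
* `KerrCap.capRawNormal_pointwise`: at `u ≠ 0` the raw normal `Ñ = g♯n` (`Kerr.coSharp`) is timelike,
  `g(V, Ñ) = ϱ′ + 2H(ϱ′ + τ′) > 0`, `g(Ñ, DΦv) = n(DΦv) = ϱ′τ′⟪u,v⟫/s − τ′ϱ′⟪u,v⟫/s = 0`, and `DΦ(u)` is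
  injective (`DΦv = 0 ⇒ (τ′ + ϱ′)⟪u,v⟫ = 0 ⇒ v ⊥ u ⇒ v = 0`, `eq_zero_of_fderiv_capMap_eq_zero`);
* `KerrCap.contDiffAt_capNormal`: `N = −Ñ/√(−g(Ñ,Ñ))` is `C^∞` off the origin (closed form
  `Ñ = (−ϱ′, −τ′∇r) + 2H(ϱ′ + τ′)ℓ♯`, `coSharp_capConormal_eq`);
* **`stub_capImmersion`**: the radius identity, `IsSpacelikeImmersion` (O'Neill Lemma 5.26 via
  `LorentzianMetric.isSpacelike_of_orthogonal`) and `IsFutureUnitNormal` for `Kerr.timeOrientation`, packaged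
  as in `Negative.isFutureUnitNormal_graphNormal`.

References: Visser arXiv:0706.0622, (32)–(36); O'Neill 1983, Ch. 5, Lemma 5.26; Dafermos–Rodnianski
arXiv:0811.0354, §5.1; Wald 1984, §10.2.
-/

-- the doubled `FinalStateConjecture` path component is the summit/problem naming scheme, not a mistake
set_option linter.dupNamespace false

noncomputable section

open Set Function Filter Topology TopologicalSpace
open scoped Manifold ContDiff Topology InnerProductSpace
open Literature.Geometry.Lorentzian
open Summit.FinalStateConjecture.FinalStateConjecture.Theorems.KerrShieldedDataExist

namespace Summit.FinalStateConjecture.FinalStateConjecture.Theorems.SwallowTheDatum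

namespace KerrCap

/-! ### The sign of the conormal square along the profile -/

/-- **`Σ g⁻¹(n, n) < 0` along the cap profile.** For profiles as in the stub (`τ′, ϱ′ ≥ 0`, `τ′ + ϱ′ > 0`,
`r₋ < r₀ ≤ ϱ`, `ϱ ≤ r_b < r₊` on `s ≤ σ₄`, `τ = T_{M,a}∘ϱ + c` with `ϱ′ > 0` on `s ≥ σ₄`) and every `S ≥ ϱ(s)²`
(the Boyer–Lindquist `Σ` at a point of radius `ϱ(s)`),
`−Sϱ′² + τ′²(ϱ² + a²) − 2Mϱ(ϱ′ + τ′)² < 0`: black-hole zone `Δ(ϱ) < 0` for `s ≤ σ₄`, graph zone `τ′ = T′(ϱ)ϱ′` and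
`Negative.conormalForm_bentSlope_neg` for `s > σ₄`. [cite: arXiv08110354, §5.1] -/
theorem capNum_neg {M a r₀ σ₄ c rb : ℝ} {τ ϱ : ℝ → ℝ} (ha : |a| < M) (hr₀ : Kerr.rMinus M a < r₀)
    (hrb : rb < Kerr.rPlus M a) (hϱs : ContDiff ℝ ∞ ϱ) (hϱge : ∀ s, r₀ ≤ ϱ s)
    (hτ' : ∀ s, 0 ≤ deriv τ s) (hϱ' : ∀ s, 0 ≤ deriv ϱ s) (hsum : ∀ s, 0 < deriv τ s + deriv ϱ s)
    (hle : ∀ s, s ≤ σ₄ → ϱ s ≤ rb)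
    (hgraph : ∀ s, σ₄ ≤ s → τ s = Negative.bentHeight M a (ϱ s) + c ∧ 0 < deriv ϱ s)
    (s : ℝ) {S : ℝ} (hS : ϱ s ^ 2 ≤ S) :
    -S * deriv ϱ s ^ 2 + deriv τ s ^ 2 * (ϱ s ^ 2 + a ^ 2) - 2 * M * ϱ s * (deriv ϱ s + deriv τ s) ^ 2 < 0 := by
  have hM := Negative.mass_pos ha
  have hr : 0 < ϱ s := ((Negative.rMinus_nonneg ha).trans_lt hr₀).trans_le (hϱge s)
  have hSpos : 0 < S := lt_of_lt_of_le (by positivity) hS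
  rcases le_or_gt s σ₄ with hs | hs
  · -- black-hole zone: `Δ(ϱ) = (ϱ − r₊)(ϱ − r₋) < 0`
    have hΔ : ϱ s ^ 2 - 2 * M * ϱ s + a ^ 2 < 0 := by
      rw [Negative.delta_factor ha]
      exact mul_neg_of_neg_of_pos (by linarith [hle s hs]) (by linarith [hϱge s])
    exact capConormalNum_neg_of_delta_neg hM.le hr hSpos (hϱ' s) (hτ' s) (by linarith [hsum s]) hΔ
  · -- graph zone: `τ′ = T′(ϱ) ϱ′`
    have hdϱ : HasDerivAt ϱ (deriv ϱ s) s := (hϱs.differentiable (by simp)).differentiableAt.hasDerivAt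
    have hev : τ =ᶠ[𝓝 s] fun s ↦ Negative.bentHeight M a (ϱ s) + c := by
      filter_upwards [Ioi_mem_nhds hs] with s' hs'
      exact (hgraph s' (le_of_lt hs')).1
    have h1 : HasDerivAt (fun s ↦ Negative.bentHeight M a (ϱ s) + c)
        (Negative.bentSlope M a (ϱ s) * deriv ϱ s) s := by
      have hc : HasDerivAt (Negative.bentHeight M a ∘ ϱ) (Negative.bentSlope M a (ϱ s) * deriv ϱ s) s :=
        (Negative.hasDerivAt_bentHeight ha (ϱ s)).comp s hdϱ
      exact hc.add_const c
    have hq : deriv τ s = Negative.bentSlope M a (ϱ s) * deriv ϱ s := (h1.congr_of_eventuallyEq hev).deriv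
    exact capConormalNum_neg_of_slope ha hr hS (hgraph s hs.le).2 hq

/-! ### The raw normal at a point of the cap -/

section Pointwise

variable {M a r₀ σ₄ c rb : ℝ} {τ ϱ α : ℝ → ℝ} {X : E3 → E3}

/-- **The raw normal `Ñ = g♯(ϱ′dt* − τ′dr)` of the cap map at `Φ(u)`, `u ≠ 0`**: the point has `r = ϱ(s) > 0`;
`g(Ñ, Ñ) = (−Σϱ′² + τ′²(r² + a²) − 2Mr(ϱ′ + τ′)²)/Σ < 0` (`capNum_neg`, `r² ≤ Σ`); `g(V, Ñ) = ϱ′ + 2H(ϱ′ + τ′) > 0`;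
`g(Ñ, DΦ(u)v) = ϱ′·τ′⟪u,v⟫/s − τ′·dr(DX(u)v) = 0` (`dr(DX v) = ϱ′⟪u,v⟫/s`); and `DΦ(u)v = 0` forces
`(τ′ + ϱ′)⟪u,v⟫ = 0`, hence `v ⊥ u`, hence `v = 0`. [cite: ONeill1983, Ch. 5 Lemma 5.26] [cite: arXiv08110354, §5.1] -/
theorem capRawNormal_pointwise (ha : |a| < M) (hr₀ : Kerr.rMinus M a < r₀) (hrb : rb < Kerr.rPlus M a)
    (hτs : ContDiff ℝ ∞ τ) (hϱs : ContDiff ℝ ∞ ϱ) (hαs : ContDiff ℝ ∞ α) (hϱge : ∀ s, r₀ ≤ ϱ s)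
    (hτ' : ∀ s, 0 ≤ deriv τ s) (hϱ' : ∀ s, 0 ≤ deriv ϱ s) (hsum : ∀ s, 0 < deriv τ s + deriv ϱ s)
    (hle : ∀ s, s ≤ σ₄ → ϱ s ≤ rb)
    (hgraph : ∀ s, σ₄ ≤ s → τ s = Negative.bentHeight M a (ϱ s) + c ∧ 0 < deriv ϱ s)
    (hX : ∀ u : E3, X u =
      !₂[(ϱ ‖u‖ * (Real.cos (α ‖u‖) * u 0 - Real.sin (α ‖u‖) * u 1) -
            a * (Real.sin (α ‖u‖) * u 0 + Real.cos (α ‖u‖) * u 1)) / ‖u‖,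
         (ϱ ‖u‖ * (Real.sin (α ‖u‖) * u 0 + Real.cos (α ‖u‖) * u 1) +
            a * (Real.cos (α ‖u‖) * u 0 - Real.sin (α ‖u‖) * u 1)) / ‖u‖,
         ϱ ‖u‖ * u 2 / ‖u‖])
    {u : E3} (hu : u ≠ 0) {n : E4 →ₗ[ℝ] ℝ}
    (hn : ∀ w, n w = deriv ϱ ‖u‖ * w 0 - deriv τ ‖u‖ * Kerr.radiusGrad a (X u) (E4.spatial w)) :
    0 < Kerr.radius a (E4.ofTimeSpace (τ ‖u‖) (X u)) ∧
      Kerr.bilin M a (E4.ofTimeSpace (τ ‖u‖) (X u))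
          (Kerr.coSharp M a (E4.ofTimeSpace (τ ‖u‖) (X u)) n)
          (Kerr.coSharp M a (E4.ofTimeSpace (τ ‖u‖) (X u)) n) < 0 ∧
      0 < Kerr.bilin M a (E4.ofTimeSpace (τ ‖u‖) (X u))
          (Kerr.timeVector M a (E4.ofTimeSpace (τ ‖u‖) (X u)))
          (Kerr.coSharp M a (E4.ofTimeSpace (τ ‖u‖) (X u)) n) ∧
      (∀ v : E3, Kerr.bilin M a (E4.ofTimeSpace (τ ‖u‖) (X u))
          (Kerr.coSharp M a (E4.ofTimeSpace (τ ‖u‖) (X u)) n)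
          (fderiv ℝ (fun u : E3 ↦ E4.ofTimeSpace (τ ‖u‖) (X u)) u v) = 0) ∧
      ∀ v : E3, fderiv ℝ (fun u : E3 ↦ E4.ofTimeSpace (τ ‖u‖) (X u)) u v = 0 → v = 0 := by
  have hM := Negative.mass_pos ha
  have hϱ0 : ∀ s, 0 < ϱ s := fun s ↦ ((Negative.rMinus_nonneg ha).trans_lt hr₀).trans_le (hϱge s)
  have hr : 0 < Kerr.radius a (E4.ofTimeSpace 0 (X u)) := by
    rw [radius_capMap hX hu (hϱ0 _) 0]; exact hϱ0 _
  have hrt : 0 < Kerr.radius a (E4.ofTimeSpace (τ ‖u‖) (X u)) := by rwa [Kerr.radius_ofTimeSpace]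
  have hs0 : ‖u‖ ≠ 0 := norm_ne_zero_iff.2 hu
  have hpq : 0 < deriv ϱ ‖u‖ + deriv τ ‖u‖ := by linarith [hsum ‖u‖]
  refine ⟨hrt, ?_, ?_, fun v ↦ ?_, fun v hv ↦ ?_⟩
  · -- `g(Ñ, Ñ) < 0`
    have hS := Kerr.blSigma_pos hr
    have hSr := Kerr.sq_le_blSigma hr
    rw [bilin_coSharp_capConormal_self hn hr]
    rw [radius_capMap hX hu (hϱ0 _) 0] at hSr ⊢
    apply div_neg_of_neg_of_pos _ hS
    have key := capNum_neg ha hr₀ hrb hϱs hϱge hτ' hϱ' hsum hle hgraph ‖u‖ hSr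
    linarith
  · -- `g(V, Ñ) > 0`
    rw [bilin_timeVector_coSharp_capConormal hn hr, ← capConormal_timeVector hn hr]
    exact capConormal_timeVector_pos hn hr hM (hϱ' _) hpq
  · -- tangency
    rw [bilin_coSharp_capConormal hr, hn, fderiv_capImm_apply hX hτs hϱs hαs hu, E4.ofTimeSpace_apply_zero,
      E4.spatial_ofTimeSpace, radiusGrad_fderiv_capMap hX hϱs hαs hϱ0 hu]
    ring
  · -- injectivity of `DΦ(u)`
    rw [fderiv_capImm_apply hX hτs hϱs hαs hu] at hv
    have hsp : fderiv ℝ X u v = 0 := by simpa using congrArg E4.spatial hv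
    have ht : deriv τ ‖u‖ * ‖u‖⁻¹ * ⟪u, v⟫_ℝ = 0 := by simpa using congrArg (fun w : E4 ↦ w 0) hv
    have hrr : deriv ϱ ‖u‖ * ‖u‖⁻¹ * ⟪u, v⟫_ℝ = 0 := by
      rw [← radiusGrad_fderiv_capMap hX hϱs hαs hϱ0 hu v, hsp, map_zero]
    have huv : ⟪u, v⟫_ℝ = 0 := by
      have h1 : (deriv ϱ ‖u‖ + deriv τ ‖u‖) * ‖u‖⁻¹ * ⟪u, v⟫_ℝ = 0 := by linear_combination hrr + ht
      rcases mul_eq_zero.1 h1 with h2 | h2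
      · rcases mul_eq_zero.1 h2 with h3 | h3
        · exact absurd h3 hpq.ne'
        · exact absurd h3 (inv_ne_zero hs0)
      · exact h2
    exact eq_zero_of_fderiv_capMap_eq_zero hX hϱs hαs hu (hϱ0 _) huv hsp

/-- **The future unit normal `N = −Ñ/√(−g(Ñ, Ñ))` of the cap map is `C^∞` off the origin**: near `u ≠ 0` the
raw normal is `Ñ = (−ϱ′, −τ′∇r(X)) + 2H(Φ)(ϱ′ + τ′) ℓ♯(Φ)` (`coSharp_capConormal_eq`), a composite of `C^∞` maps
(`ϱ′, τ′` of `‖·‖`; `∇r`, `H`, `ℓ♯` are smooth where `r > 0`), and `g(Ñ, Ñ) < 0`. [folklore] -/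
theorem contDiffAt_capNormal (ha : |a| < M) (hr₀ : Kerr.rMinus M a < r₀) (hrb : rb < Kerr.rPlus M a)
    (hτs : ContDiff ℝ ∞ τ) (hϱs : ContDiff ℝ ∞ ϱ) (hαs : ContDiff ℝ ∞ α) (hϱge : ∀ s, r₀ ≤ ϱ s)
    (hτ' : ∀ s, 0 ≤ deriv τ s) (hϱ' : ∀ s, 0 ≤ deriv ϱ s) (hsum : ∀ s, 0 < deriv τ s + deriv ϱ s)
    (hle : ∀ s, s ≤ σ₄ → ϱ s ≤ rb)
    (hgraph : ∀ s, σ₄ ≤ s → τ s = Negative.bentHeight M a (ϱ s) + c ∧ 0 < deriv ϱ s)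
    (hX : ∀ u : E3, X u =
      !₂[(ϱ ‖u‖ * (Real.cos (α ‖u‖) * u 0 - Real.sin (α ‖u‖) * u 1) -
            a * (Real.sin (α ‖u‖) * u 0 + Real.cos (α ‖u‖) * u 1)) / ‖u‖,
         (ϱ ‖u‖ * (Real.sin (α ‖u‖) * u 0 + Real.cos (α ‖u‖) * u 1) +
            a * (Real.cos (α ‖u‖) * u 0 - Real.sin (α ‖u‖) * u 1)) / ‖u‖,
         ϱ ‖u‖ * u 2 / ‖u‖])
    {Nr N : E3 → E4}
    (hNr : ∀ u, Nr u = Kerr.coSharp M a (E4.ofTimeSpace (τ ‖u‖) (X u))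
      (((deriv ϱ ‖u‖) • (E4.dx 0 : E4 →L[ℝ] ℝ) -
        (deriv τ ‖u‖) • (Kerr.radiusGrad a (X u)).comp E4.spatial : E4 →L[ℝ] ℝ) : E4 →ₗ[ℝ] ℝ))
    (hN : ∀ u, N u = -((Real.sqrt (-Kerr.bilin M a (E4.ofTimeSpace (τ ‖u‖) (X u)) (Nr u) (Nr u)))⁻¹ • Nr u))
    {u : E3} (hu : u ≠ 0) : ContDiffAt ℝ ∞ N u := by
  have hϱ0 : ∀ s, 0 < ϱ s := fun s ↦ ((Negative.rMinus_nonneg ha).trans_lt hr₀).trans_le (hϱge s)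
  have hn : ∀ (w' : E3) (w : E4), ((((deriv ϱ ‖w'‖) • (E4.dx 0 : E4 →L[ℝ] ℝ) -
      (deriv τ ‖w'‖) • (Kerr.radiusGrad a (X w')).comp E4.spatial : E4 →L[ℝ] ℝ) : E4 →ₗ[ℝ] ℝ)) w =
      deriv ϱ ‖w'‖ * w 0 - deriv τ ‖w'‖ * Kerr.radiusGrad a (X w') (E4.spatial w) := fun w' w ↦ by
    simp
  -- the closed form of the raw normal near `u`
  have hNr' : Nr =ᶠ[𝓝 u] fun w ↦ E4.ofTimeSpace (-deriv ϱ ‖w‖) (-(deriv τ ‖w‖ • Kerr.radiusGradVec a (X w))) +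
      (2 * Kerr.scalarH M a (E4.ofTimeSpace (τ ‖w‖) (X w)) * (deriv ϱ ‖w‖ + deriv τ ‖w‖)) •
        Kerr.nullVector a (E4.ofTimeSpace (τ ‖w‖) (X w)) := by
    filter_upwards [isOpen_compl_singleton.mem_nhds hu] with w hw
    have hrw : 0 < Kerr.radius a (E4.ofTimeSpace 0 (X w)) := by
      rw [radius_capMap hX hw (hϱ0 _) 0]; exact hϱ0 _
    rw [hNr w]
    exact coSharp_capConormal_eq (hn w) hrw
  have hr : 0 < Kerr.radius a (E4.ofTimeSpace 0 (X u)) := by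
    rw [radius_capMap hX hu (hϱ0 _) 0]; exact hϱ0 _
  have hrt : 0 < Kerr.radius a (E4.ofTimeSpace (τ ‖u‖) (X u)) := by rwa [Kerr.radius_ofTimeSpace]
  -- smoothness of the ingredients
  have hnorm : ContDiffAt ℝ ∞ (fun w : E3 ↦ ‖w‖) u := contDiffAt_norm ℝ hu
  have hp : ContDiffAt ℝ ∞ (fun w : E3 ↦ deriv ϱ ‖w‖) u :=
    (contDiff_infty_iff_deriv.mp hϱs).2.contDiffAt.comp u hnorm
  have hq : ContDiffAt ℝ ∞ (fun w : E3 ↦ deriv τ ‖w‖) u :=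
    (contDiff_infty_iff_deriv.mp hτs).2.contDiffAt.comp u hnorm
  have hXc : ContDiffAt ℝ ∞ X u := contDiffAt_capMap hX hϱs hαs hu
  have hΦ : ContDiffAt ℝ ∞ (fun w : E3 ↦ E4.ofTimeSpace (τ ‖w‖) (X w)) u := contDiffAt_capImm hX hτs hϱs hαs hu
  have hgrad : ContDiffAt ℝ ∞ (fun w : E3 ↦ Kerr.radiusGradVec a (X w)) u :=
    (contDiffAt_radiusGradVec hr).comp u hXc
  have hH : ContDiffAt ℝ ∞ (fun w : E3 ↦ Kerr.scalarH M a (E4.ofTimeSpace (τ ‖w‖) (X w))) u :=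
    ContDiffAt.comp (g := Kerr.scalarH M a) u (Kerr.contDiffAt_scalarH M a hrt) hΦ
  have hℓ : ContDiffAt ℝ ∞ (fun w : E3 ↦ Kerr.nullVector a (E4.ofTimeSpace (τ ‖w‖) (X w))) u :=
    ContDiffAt.comp (g := Kerr.nullVector a) u (Kerr.contDiffAt_nullVector a hrt) hΦ
  have hE : ContDiffAt ℝ ∞ (fun w ↦ E4.ofTimeSpace (-deriv ϱ ‖w‖) (-(deriv τ ‖w‖ • Kerr.radiusGradVec a (X w))) +
      (2 * Kerr.scalarH M a (E4.ofTimeSpace (τ ‖w‖) (X w)) * (deriv ϱ ‖w‖ + deriv τ ‖w‖)) •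
        Kerr.nullVector a (E4.ofTimeSpace (τ ‖w‖) (X w))) u := by
    have hfun : (fun w ↦ E4.ofTimeSpace (-deriv ϱ ‖w‖) (-(deriv τ ‖w‖ • Kerr.radiusGradVec a (X w))) +
        (2 * Kerr.scalarH M a (E4.ofTimeSpace (τ ‖w‖) (X w)) * (deriv ϱ ‖w‖ + deriv τ ‖w‖)) •
          Kerr.nullVector a (E4.ofTimeSpace (τ ‖w‖) (X w))) =
        fun w ↦ (-deriv ϱ ‖w‖) • E4.basisVector 0 +
          E4.spaceEmbed (-(deriv τ ‖w‖ • Kerr.radiusGradVec a (X w))) +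
          (2 * Kerr.scalarH M a (E4.ofTimeSpace (τ ‖w‖) (X w)) * (deriv ϱ ‖w‖ + deriv τ ‖w‖)) •
            Kerr.nullVector a (E4.ofTimeSpace (τ ‖w‖) (X w)) := by
      funext w; rw [E4.ofTimeSpace_eq_smul_add']
    rw [hfun]
    exact ((hp.neg.smul contDiffAt_const).add (E4.spaceEmbed.contDiff.contDiffAt.comp u (hq.smul hgrad).neg)).add
      (((contDiffAt_const.mul hH).mul (hp.add hq)).smul hℓ)
  have hNrc : ContDiffAt ℝ ∞ Nr u := hE.congr_of_eventuallyEq hNr'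
  -- the normalising factor
  have hQ : ContDiffAt ℝ ∞ (fun w ↦ Kerr.bilin M a (E4.ofTimeSpace (τ ‖w‖) (X w)) (Nr w) (Nr w)) u :=
    ((ContDiffAt.comp (g := Kerr.bilin M a) u (Kerr.contDiffAt_bilin M a hrt) hΦ).clm_apply hNrc).clm_apply hNrc
  have hQneg : Kerr.bilin M a (E4.ofTimeSpace (τ ‖u‖) (X u)) (Nr u) (Nr u) < 0 := by
    rw [hNr u]
    exact (capRawNormal_pointwise ha hr₀ hrb hτs hϱs hαs hϱge hτ' hϱ' hsum hle hgraph hX hu (hn u)).2.1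
  have hsq : ContDiffAt ℝ ∞ (fun w ↦ (Real.sqrt (-Kerr.bilin M a (E4.ofTimeSpace (τ ‖w‖) (X w)) (Nr w) (Nr w)))⁻¹) u :=
    (hQ.neg.sqrt (by linarith)).inv (Real.sqrt_pos.2 (by linarith)).ne'
  have hfunN : N = fun w ↦ -((Real.sqrt (-Kerr.bilin M a (E4.ofTimeSpace (τ ‖w‖) (X w)) (Nr w) (Nr w)))⁻¹ • Nr w) :=
    funext hN
  rw [hfunN]
  exact (hsq.smul hNrc).neg

end Pointwise

end KerrCap

/-! ### The stub -/

/-- **Stub `stub_capImmersion` of the line `plug-the-second-sheet` (v4 "KerrCap"), proved verbatim** (Kerr–Schild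
chart calculus, all spins): for profiles `(τ, ϱ, α)` with `τ′, ϱ′ ≥ 0` never both `0`, `r₋ < r₀ ≤ ϱ`,
`ϱ ≤ r_b < r₊` on `s ≤ σ₄` and `τ = T_{M,a}∘ϱ + c`, `ϱ′ > 0` on `s ≥ σ₄`, the cap map
`Ψ(u) = (τ(s), L_{ϱ(s)} Rot_z(α(s)) (u/s))`, `s = ‖u‖`, has Kerr–Schild radius `r = ϱ(s)` (`KerrCap.radius_capMap`)
and is a smooth spacelike immersion of `{‖u‖ > σ}` into `(Kerr.region a r_c, g_{M,a})` with a `C^∞` future unit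
normal: its conormal `ϱ′dt* − τ′dr` annihilates `dΨ` and has `g⁻¹`-square
`(−Σϱ′² + τ′²(r² + a²) − 2Mr(ϱ′ + τ′)²)/Σ < 0` (`KerrCap.capNum_neg`), `g(V, ·) > 0` on the raw normal fixes
the future sign, and `Kerr.bilin_pos_of_orthogonal` (O'Neill Lemma 5.26) gives positivity of the induced form.
[cite: arXiv07060622, (32)–(36)] [cite: ONeill1983, Ch. 5 Lemma 5.26] -/
theorem stub_capImmersion :
    ∀ [Kerr.Facts] (M a r₀ σ σ₄ c rb rc : ℝ) (hM : 0 ≤ M) (τ ϱ α : ℝ → ℝ) (X : E3 → E3),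
      |a| < M → Kerr.rMinus M a < r₀ → rb < Kerr.rPlus M a → 0 ≤ rc → rc < r₀ → 0 < σ →
      ContDiff ℝ ∞ τ → ContDiff ℝ ∞ ϱ → ContDiff ℝ ∞ α →
      (∀ s, r₀ ≤ ϱ s) → (∀ s, 0 ≤ deriv τ s) → (∀ s, 0 ≤ deriv ϱ s) → (∀ s, 0 < deriv τ s + deriv ϱ s) →
      (∀ s, s ≤ σ₄ → ϱ s ≤ rb) →
      (∀ s, σ₄ ≤ s → τ s = Negative.bentHeight M a (ϱ s) + c ∧ 0 < deriv ϱ s) →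
      (∀ u : E3, X u =
        !₂[(ϱ ‖u‖ * (Real.cos (α ‖u‖) * u 0 - Real.sin (α ‖u‖) * u 1) -
              a * (Real.sin (α ‖u‖) * u 0 + Real.cos (α ‖u‖) * u 1)) / ‖u‖,
           (ϱ ‖u‖ * (Real.sin (α ‖u‖) * u 0 + Real.cos (α ‖u‖) * u 1) +
              a * (Real.cos (α ‖u‖) * u 0 - Real.sin (α ‖u‖) * u 1)) / ‖u‖,
           ϱ ‖u‖ * u 2 / ‖u‖]) →
      (∀ (t : ℝ) (u : E3), u ≠ 0 → Kerr.radius a (E4.ofTimeSpace t (X u)) = ϱ ‖u‖) ∧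
      ∀ (Ω : Opens E3) (Ψ : Ω → Kerr.region a rc), (Ω : Set E3) = {u : E3 | σ < ‖u‖} →
        (∀ u : Ω, (Ψ u : E4) = E4.ofTimeSpace (τ ‖(u : E3)‖) (X u)) →
        (Kerr.smoothMetric M a rc).IsSpacelikeImmersion 𝓘(ℝ, E3) Ψ ∧
        ∃ N : E3 → E4, ContDiffOn ℝ ∞ N Ω ∧
          (Kerr.smoothMetric M a rc).IsFutureUnitNormal 𝓘(ℝ, E3)
            ((Kerr.timeOrientation M a rc hM).ofLE le_top) Ψ (fun u ↦ N u) := by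
  intro inst M a r₀ σ σ₄ c rb rc hM τ ϱ α X ha hr₀ hrb _hrc0 _hrc hσ hτs hϱs hαs hϱge hτ' hϱ' hsum hle
    hgraph hX
  have hϱ0 : ∀ s, 0 < ϱ s := fun s ↦ ((Negative.rMinus_nonneg ha).trans_lt hr₀).trans_le (hϱge s)
  refine ⟨fun t u hu ↦ KerrCap.radius_capMap hX hu (hϱ0 _) t, fun Ω Ψ hΩ hΨ ↦ ?_⟩
  -- points of `Ω` are off the origin
  have hne : ∀ u : Ω, (u : E3) ≠ 0 := by
    intro u h0
    have hu : (u : E3) ∈ (Ω : Set E3) := u.2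
    rw [hΩ, Set.mem_setOf_eq, h0, norm_zero] at hu
    exact lt_irrefl 0 (hσ.trans hu)
  -- the conormal and the raw normal, as explicit functions of `u`
  set nf : E3 → E4 →ₗ[ℝ] ℝ := fun u ↦
    (((deriv ϱ ‖u‖) • (E4.dx 0 : E4 →L[ℝ] ℝ) -
      (deriv τ ‖u‖) • (Kerr.radiusGrad a (X u)).comp E4.spatial : E4 →L[ℝ] ℝ) : E4 →ₗ[ℝ] ℝ) with hnf
  have hn : ∀ (u : E3) (w : E4),
      nf u w = deriv ϱ ‖u‖ * w 0 - deriv τ ‖u‖ * Kerr.radiusGrad a (X u) (E4.spatial w) := fun u w ↦ by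
    simp [hnf]
  set Nr : E3 → E4 := fun u ↦ Kerr.coSharp M a (E4.ofTimeSpace (τ ‖u‖) (X u)) (nf u) with hNr
  set N : E3 → E4 := fun u ↦
    -((Real.sqrt (-Kerr.bilin M a (E4.ofTimeSpace (τ ‖u‖) (X u)) (Nr u) (Nr u)))⁻¹ • Nr u) with hNdef
  have key := fun u : Ω ↦ KerrCap.capRawNormal_pointwise ha hr₀ hrb hτs hϱs hαs hϱge hτ' hϱ' hsum hle hgraph hX
    (hne u) (hn u)
  have hΦd : ∀ u : Ω, DifferentiableAt ℝ (fun u : E3 ↦ E4.ofTimeSpace (τ ‖u‖) (X u)) (u : E3) := fun u ↦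
    KerrCap.differentiableAt_capImm hX hτs hϱs hαs (hne u)
  -- the raw normal: timelike, future, orthogonal to the tangent vectors
  have hQneg : ∀ u : Ω, Kerr.bilin M a (Ψ u : E4) (Nr u) (Nr u) < 0 := fun u ↦ by
    rw [hΨ u]; exact (key u).2.1
  have hsqrt : ∀ u : Ω, 0 < Real.sqrt (-Kerr.bilin M a (E4.ofTimeSpace (τ ‖(u : E3)‖) (X u)) (Nr u) (Nr u)) :=
    fun u ↦ Real.sqrt_pos.2 (by linarith [(key u).2.1])
  have hNN : ∀ u : Ω, Kerr.bilin M a (Ψ u : E4) (N u) (N u) = -1 := fun u ↦ by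
    rw [hΨ u]
    set Q := Kerr.bilin M a (E4.ofTimeSpace (τ ‖(u : E3)‖) (X u)) (Nr u) (Nr u) with hQ
    have hQ0 : Q < 0 := (key u).2.1
    have hs2 : Real.sqrt (-Q) ^ 2 = -Q := Real.sq_sqrt (by linarith)
    have e : Kerr.bilin M a (E4.ofTimeSpace (τ ‖(u : E3)‖) (X u)) (N u) (N u) = (Real.sqrt (-Q))⁻¹ ^ 2 * Q := by
      simp only [hNdef, E4.bilin_neg_neg, map_smul, FunLike.coe_smul, Pi.smul_apply, smul_eq_mul, ← hQ]
      ring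
    rw [e, inv_pow, hs2, inv_mul_eq_div, div_neg, div_self hQ0.ne]
  have hNw : ∀ (u : Ω) (w : E4), Kerr.bilin M a (Ψ u : E4) (N u) w =
      -(Real.sqrt (-Kerr.bilin M a (E4.ofTimeSpace (τ ‖(u : E3)‖) (X u)) (Nr u) (Nr u)))⁻¹ *
        Kerr.bilin M a (E4.ofTimeSpace (τ ‖(u : E3)‖) (X u)) (Nr u) w := fun u w ↦ by
    rw [hΨ u]
    simp only [hNdef, map_neg, map_smul, FunLike.coe_neg, FunLike.coe_smul, Pi.neg_apply, Pi.smul_apply,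
      smul_eq_mul, neg_mul]
  refine ⟨⟨?_, fun u v hv ↦ ?_⟩, N, fun u hu ↦ ?_, ⟨⟨fun u v ↦ ?_, fun u ↦ ?_⟩, fun u ↦ ⟨?_, ?_⟩⟩⟩
  · -- `Ψ` is `C^∞` (indeed `C^n` for every `n`)
    intro u
    exact (ChartedSpace.liftPropWithinAt_subtypeVal_comp_iff Ψ Set.univ u).mp
      ((OpensChart.contMDiffAt_iff u (Subtype.val ∘ Ψ) (fun u : E3 ↦ E4.ofTimeSpace (τ ‖u‖) (X u))
        (fun z ↦ hΨ z)).2 (KerrCap.contDiffAt_capImm hX hτs hϱs hαs (hne u)))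
  · -- positivity of the induced form
    rw [PseudoRiemannianMetric.inducedBilin_apply, Kerr.smoothMetric_val,
      OpensChart.mfderiv_apply_of_repr hΨ (hΦd u)]
    set w : E3 := v with hw
    have hw0 : w ≠ 0 := hv
    have htl : (Kerr.smoothMetric M a rc).IsTimelike (x := Ψ u) (Nr u) := by
      rw [LorentzianMetric.isTimelike_iff, Kerr.smoothMetric_val]
      exact hQneg u
    have horth : (Kerr.smoothMetric M a rc).val (Ψ u) (Nr u)
        (fderiv ℝ (fun u : E3 ↦ E4.ofTimeSpace (τ ‖u‖) (X u)) u w) = 0 := by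
      rw [Kerr.smoothMetric_val, hΨ u]; exact (key u).2.2.2.1 w
    rcases (Kerr.smoothMetric M a rc).isSpacelike_of_orthogonal htl horth with hpos | hzero
    · rw [Kerr.smoothMetric_val] at hpos
      exact hpos
    · exact absurd ((key u).2.2.2.2 w hzero) hw0
  · -- smoothness of `N` on `Ω`
    have hu0 : u ≠ 0 := hne ⟨u, hu⟩
    exact (KerrCap.contDiffAt_capNormal ha hr₀ hrb hτs hϱs hαs hϱge hτ' hϱ' hsum hle hgraph hX
      (Nr := Nr) (N := N) (fun _ ↦ rfl) (fun _ ↦ rfl) hu0).contDiffWithinAt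
  · -- normal
    rw [Kerr.smoothMetric_val, OpensChart.mfderiv_apply_of_repr hΨ (hΦd u)]
    show Kerr.bilin M a (Ψ u : E4) (N u) _ = 0
    rw [hNw u, (key u).2.2.2.1 v, mul_zero]
  · -- unit
    rw [Kerr.smoothMetric_val]
    exact hNN u
  · -- causal
    have ht : (Kerr.smoothMetric M a rc).IsTimelike (x := Ψ u) (N u) := by
      rw [LorentzianMetric.isTimelike_iff, Kerr.smoothMetric_val]
      show Kerr.bilin M a (Ψ u : E4) (N u) (N u) < 0
      rw [hNN u]; norm_num
    exact ht.isCausal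
  · -- future
    rw [TimeOrientation.vectorField_ofLE, Kerr.smoothMetric_val]
    show Kerr.bilin M a (Ψ u : E4) (Kerr.timeVector M a (Ψ u : E4)) (N u) < 0
    rw [hΨ u]
    simp only [hNdef, map_neg, map_smul, smul_eq_mul, neg_lt_zero]
    exact mul_pos (inv_pos.2 (hsqrt u)) (key u).2.2.1

end Summit.FinalStateConjecture.FinalStateConjecture.Theorems.SwallowTheDatum

end
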